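import Summits.KontsevichZagierPeriods.KontsevichZagierPeriods.Theses.LiftingCriteria
import Literature.NumberTheory.Transcendental.KZKernelConjectureForms
import Literature.NumberTheory.Transcendental.KZCubicalCalculus

/-!
# `DilationLiftAtOne` (stmt-KontsevichZagierPeriods-3571) — the exact strength of the bet (lead c2)

Kernel-checked structure theorems for the crux `DilationLiftAtOne` of route LiftingCriteria (no
`sorry`; nothing here is a stub of the registered skeleton `Lines/birth.lean`, whose single open stub
`stub_glueAtOne` is crux-equivalent):

* `KZCube` — the Kontsevich–Zagier conjecture in KERNEL FORM restricted to `ℤ`-combinations of the unit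
  representation and cube-Nash representations (`m₀·[1] + Σ mᵢ·[∫_{[0,1]^{nᵢ}} gᵢ]` with value `0` is a
  KZ relation). It is implied by the summit: `kzCube_of_kontsevichZagierPeriods`.
* `MovesLift` — the CONVERSE of the route's crux `DilationTransfer` at `ϖ₀ = 1`: a combination of
  cube-Nash representations that is a KZ relation has a dilation function in `(ϖ − 1)·D`
  ("KZ moves lift to the dilation pencil"). Transcendence-free in content (it only speaks about
  combinations already known to be relations), but not in print.
* `movesLift_of_dilationLiftAtOne : DilationLiftAtOne → MovesLift` (soundness of the calculus);
* `dilationLiftAtOne_of_kzCube_of_movesLift : KZCube → MovesLift → DilationLiftAtOne`;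
* `kzCube_of_dilationTransfer_of_dilationLiftAtOne : DilationTransfer → DilationLiftAtOne → KZCube`;
* hence `dilationLiftAtOne_iff : DilationTransfer → (DilationLiftAtOne ↔ KZCube ∧ MovesLift)` and
  `dilationLiftAtOne_of_summit_of_movesLift : KontsevichZagierPeriods → MovesLift → DilationLiftAtOne`.

Reading. Modulo the route's other crux `DilationTransfer` (rank 3, Ayoub's Théorème 1.7 + cube
calibration), the bet `DilationLiftAtOne` is EXACTLY "the summit for cube-Nash combinations" `KZCube`
plus the functional lemma `MovesLift`; its excess over the summit is `MovesLift` and nothing else, and a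
refutation of the bet that does not refute the summit must refute `MovesLift` (exhibit KZ moves among
cube-Nash integrals whose dilation function is not in `(ϖ − 1)·D`).
-/

noncomputable section

-- `Summit.KontsevichZagierPeriods.KontsevichZagierPeriods.…` is the tree's mandated layout (single-conjunct summit).
set_option linter.dupNamespace false

namespace Summit.KontsevichZagierPeriods.KontsevichZagierPeriods.Cruxes.DilationLiftAtOne.Structure

open scoped BigOperators
open MeasureTheory Set
open Literature.NumberTheory.Transcendental
open Summit.KontsevichZagierPeriods.KontsevichZagierPeriods.Theses.LiftingCriteria
  (DilationLiftAtOne DilationTransfer)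

/-! ### Vocabulary (abbreviations of sub-formulas of the route decls, verbatim) -/

/-- A **cube-Nash family**: `gᵢ` is `ℚ`-semialgebraic and real-analytic on an open `Uᵢ ⊇ [0,1]^{nᵢ}`
(the hypothesis block of `DilationLiftAtOne` / `DilationTransfer`, verbatim). [cite: KontsevichZagier2001, §1.1] -/
def IsCubeNashFamily (S : ℕ) (n : Fin S → ℕ) (g : (i : Fin S) → (Fin (n i) → ℝ) → ℝ)
    (U : (i : Fin S) → Set (Fin (n i) → ℝ)) : Prop :=
  ∀ i, IsOpen (U i) ∧ Set.pi Set.univ (fun _ : Fin (n i) => Set.Icc (0:ℝ) 1) ⊆ (U i) ∧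
    Literature.NumberTheory.Transcendental.IsSemialgebraicFunOn ℚ (U i) (g i) ∧ AnalyticOnNhd ℝ (g i) (U i)

/-- **The lift at `ϖ₀`**: `m₀ + Σ mᵢ v_{gᵢ}(ϖ) = (ϖ − ϖ₀)(μ₀(ϖ) + Σ μⱼ(ϖ) v_{Gⱼ}(ϖ))` on `[0,1]` for
further cube-Nash `Gⱼ` and polynomials `μ` with real-algebraic coefficients (the conclusion block of
`DilationLiftAtOne` at `ϖ₀ = 1`, and the hypothesis block of `DilationTransfer`, verbatim).
[cite: KontsevichZagier2001, §1.2] -/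
def HasLiftAt (ϖ₀ : ℝ) (S : ℕ) (n : Fin S → ℕ) (g : (i : Fin S) → (Fin (n i) → ℝ) → ℝ)
    (m : Fin S → ℤ) (m₀ : ℤ) : Prop :=
  ∃ (T : ℕ) (d : Fin T → ℕ) (G : (j : Fin T) → (Fin (d j) → ℝ) → ℝ) (V : (j : Fin T) → Set (Fin (d j) → ℝ)) (μ : Fin T → Polynomial ℝ) (μ₀ : Polynomial ℝ), (∀ j, IsOpen (V j) ∧ Set.pi Set.univ (fun _ : Fin (d j) => Set.Icc (0:ℝ) 1) ⊆ (V j) ∧ Literature.NumberTheory.Transcendental.IsSemialgebraicFunOn ℚ (V j) (G j) ∧ AnalyticOnNhd ℝ (G j) (V j)) ∧ (∀ j k, IsAlgebraic ℚ ((μ j).coeff k)) ∧ (∀ k, IsAlgebraic ℚ (μ₀.coeff k)) ∧ ∀ ϖ ∈ Set.Icc (0:ℝ) 1, (m₀ : ℝ) + ∑ i, (m i : ℝ) * (∫ z in Set.pi Set.univ (fun _ : Fin (n i) => Set.Icc (0:ℝ) 1), g i (ϖ • z)) = (ϖ - ϖ₀) * (μ₀.eval ϖ + ∑ j, (μ j).eval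 ϖ * (∫ z in Set.pi Set.univ (fun _ : Fin (d j) => Set.Icc (0:ℝ) 1), G j (ϖ • z)))

/-- **Representations of the family**: `sᵢ = [[0,1]^{nᵢ}, gᵢ]` and the unit representation `u = [pt, 1]`
(the representation block of `DilationTransfer`, verbatim, at `ϖ₀ = 1`). [cite: KontsevichZagier2001, §1.1] -/
def AreRepsOf (S : ℕ) (n : Fin S → ℕ) (g : (i : Fin S) → (Fin (n i) → ℝ) → ℝ)
    (s : (i : Fin S) → KZ.IntegralRep (n i)) (u : KZ.IntegralRep 0) : Prop :=
  (∀ i, (s i).domain = Set.pi Set.univ (fun _ : Fin (n i) => Set.Icc (0:ℝ) 1) ∧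
      ∀ z ∈ Set.pi Set.univ (fun _ : Fin (n i) => Set.Icc (0:ℝ) 1), (s i).integrand z = g i z) ∧
    u.domain = Set.univ ∧ ∀ x, u.integrand x = 1

/-- **`KZCube`** — the Kontsevich–Zagier conjecture in kernel form for `ℤ`-combinations of the unit
and cube-Nash representations: value `0` ⇒ KZ relation. (Implied by the summit,
`kzCube_of_kontsevichZagierPeriods`; conjecture-grade.) [cite: KontsevichZagier2001, §1.2 Conjecture 1] -/
def KZCube : Prop :=
  ∀ (S : ℕ) (n : Fin S → ℕ) (g : (i : Fin S) → (Fin (n i) → ℝ) → ℝ) (U : (i : Fin S) → Set (Fin (n i) → ℝ)),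
    IsCubeNashFamily S n g U → ∀ (m : Fin S → ℤ) (m₀ : ℤ) (s : (i : Fin S) → KZ.IntegralRep (n i))
      (u : KZ.IntegralRep 0), AreRepsOf S n g s u →
      (m₀ : ℝ) + ∑ i, (m i : ℝ) * (∫ z in Set.pi Set.univ (fun _ : Fin (n i) => Set.Icc (0:ℝ) 1), g i ((1:ℝ) • z)) = 0 →
      m₀ • KZ.of u + ∑ i, m i • KZ.of (s i) ∈ KZ.relations

/-- **`MovesLift`** — KZ moves lift to the dilation pencil at `ϖ = 1`: if `m₀·[1] + Σ mᵢ·[∫_cube gᵢ]` is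
a KZ relation then `m₀ + Σ mᵢ v_{gᵢ} ∈ (ϖ − 1)·D`. This is the converse of the route's crux
`DilationTransfer` at `ϖ₀ = 1`; it is implied by `DilationLiftAtOne` (`movesLift_of_dilationLiftAtOne`).
Not in print. [cite: KontsevichZagier2001, §1.2] -/
def MovesLift : Prop :=
  ∀ (S : ℕ) (n : Fin S → ℕ) (g : (i : Fin S) → (Fin (n i) → ℝ) → ℝ) (U : (i : Fin S) → Set (Fin (n i) → ℝ)),
    IsCubeNashFamily S n g U → ∀ (m : Fin S → ℤ) (m₀ : ℤ) (s : (i : Fin S) → KZ.IntegralRep (n i))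
      (u : KZ.IntegralRep 0), AreRepsOf S n g s u →
      m₀ • KZ.of u + ∑ i, m i • KZ.of (s i) ∈ KZ.relations → HasLiftAt 1 S n g m m₀

/-! ### Unfolding the route decls through the vocabulary -/

/-- `DilationLiftAtOne` is "vanishing at `1` ⇒ lift at `1`" (definitional unfolding).
[cite: KontsevichZagier2001, §1.2] -/
theorem dilationLiftAtOne_iff_hasLiftAt :
    DilationLiftAtOne ↔
      ∀ (S : ℕ) (n : Fin S → ℕ) (g : (i : Fin S) → (Fin (n i) → ℝ) → ℝ) (U : (i : Fin S) → Set (Fin (n i) → ℝ)),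
        IsCubeNashFamily S n g U → ∀ (m : Fin S → ℤ) (m₀ : ℤ),
        (m₀ : ℝ) + ∑ i, (m i : ℝ) * (∫ z in Set.pi Set.univ (fun _ : Fin (n i) => Set.Icc (0:ℝ) 1), g i ((1:ℝ) • z)) = 0 →
        HasLiftAt 1 S n g m m₀ :=
  Iff.rfl

/-- `DilationTransfer` at `ϖ₀ = 1`: a lift at `1` of a cube-Nash combination is a KZ relation.
[cite: AyoubRelKZRevisited, Théorème 1.7] -/
theorem transfer_at_one (hT : DilationTransfer) {S : ℕ} {n : Fin S → ℕ}
    {g : (i : Fin S) → (Fin (n i) → ℝ) → ℝ} {U : (i : Fin S) → Set (Fin (n i) → ℝ)}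
    (hg : IsCubeNashFamily S n g U) (m : Fin S → ℤ) (m₀ : ℤ) {s : (i : Fin S) → KZ.IntegralRep (n i)}
    {u : KZ.IntegralRep 0} (hsu : AreRepsOf S n g s u) (hL : HasLiftAt 1 S n g m m₀) :
    m₀ • KZ.of u + ∑ i, m i • KZ.of (s i) ∈ KZ.relations := by
  obtain ⟨T, d, G, V, μ, μ₀, hG, hμ, hμ₀, hfun⟩ := hL
  obtain ⟨hs, hu1, hu2⟩ := hsu
  exact hT S n g U hg m m₀ 1 one_pos le_rfl
    ⟨T, d, G, V, μ, μ₀, hG, hμ, hμ₀, fun ϖ hϖ => by rw [Rat.cast_one]; exact hfun ϖ hϖ⟩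
    s u (fun i => ⟨(hs i).1, fun z hz => by rw [Rat.cast_one, one_smul]; exact (hs i).2 z hz⟩) hu1 hu2

/-! ### Values of the representations -/

/-- The unit representation has value `1` (`ℝ⁰` is one point of mass `1`). [folklore] -/
theorem value_unit {u : KZ.IntegralRep 0} (hu1 : u.domain = Set.univ) (hu2 : ∀ x, u.integrand x = 1) :
    u.value = 1 := by
  have hvol : volume (Set.univ : Set (Fin 0 → ℝ)) = 1 := by
    rw [volume_pi, Measure.pi_univ]; simp
  rw [KZ.IntegralRep.value, hu1, Measure.restrict_univ, funext hu2, integral_const, smul_eq_mul,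
    mul_one, measureReal_def, hvol, ENNReal.toReal_one]

/-- A representation of `gᵢ` on the cube has value `∫_{[0,1]^{nᵢ}} gᵢ = v_{gᵢ}(1)`. [folklore] -/
theorem value_cube {N : ℕ} {h : (Fin N → ℝ) → ℝ} {r : KZ.IntegralRep N}
    (hr : r.domain = Set.pi Set.univ (fun _ : Fin N => Set.Icc (0:ℝ) 1) ∧
      ∀ z ∈ Set.pi Set.univ (fun _ : Fin N => Set.Icc (0:ℝ) 1), r.integrand z = h z) :
    r.value = ∫ z in Set.pi Set.univ (fun _ : Fin N => Set.Icc (0:ℝ) 1), h ((1:ℝ) • z) := by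
  simp only [one_smul]
  rw [KZ.IntegralRep.value, hr.1]
  exact setIntegral_congr_fun (MeasurableSet.univ_pi fun _ => measurableSet_Icc) hr.2

/-- `eval (m₀·[u] + Σ mᵢ·[sᵢ]) = m₀ + Σ mᵢ v_{gᵢ}(1)`. [cite: KontsevichZagier2001, §1.2] -/
theorem eval_combination {S : ℕ} {n : Fin S → ℕ} {g : (i : Fin S) → (Fin (n i) → ℝ) → ℝ}
    (m : Fin S → ℤ) (m₀ : ℤ) {s : (i : Fin S) → KZ.IntegralRep (n i)} {u : KZ.IntegralRep 0}
    (hsu : AreRepsOf S n g s u) :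
    KZ.eval (m₀ • KZ.of u + ∑ i, m i • KZ.of (s i)) =
      (m₀ : ℝ) + ∑ i, (m i : ℝ) * (∫ z in Set.pi Set.univ (fun _ : Fin (n i) => Set.Icc (0:ℝ) 1), g i ((1:ℝ) • z)) := by
  obtain ⟨hs, hu1, hu2⟩ := hsu
  simp only [map_add, map_sum, map_zsmul, KZ.eval_of, zsmul_eq_mul, value_unit hu1 hu2, mul_one,
    value_cube (hs _)]

/-! ### Existence of the representations -/

/-- The cube representation `[[0,1]^N, h]` of a function analytic near and `ℚ`-semialgebraic on the
closed cube. [cite: KontsevichZagier2001, §1.1] -/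
def cubeRep (N : ℕ) (h : (Fin N → ℝ) → ℝ)
    (ha : AnalyticOnNhd ℝ h (Set.pi Set.univ (fun _ : Fin N => Set.Icc (0:ℝ) 1)))
    (hs : Literature.NumberTheory.Transcendental.IsSemialgebraicFunOn ℚ (Set.pi Set.univ (fun _ : Fin N => Set.Icc (0:ℝ) 1)) h) :
    KZ.IntegralRep N where
  domain := Set.pi Set.univ (fun _ : Fin N => Set.Icc (0:ℝ) 1)
  integrand := h
  isSemialgebraic_domain := by rw [← KZ.cube_eq_pi]; exact KZ.isSemialgebraic_cube
  isSemialgebraicFunOn_integrand := hs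
  integrableOn := ha.continuousOn.integrableOn_compact (isCompact_univ_pi fun _ => isCompact_Icc)

/-- The unit representation `[ℝ⁰, 1]`. [cite: KontsevichZagier2001, §1.1] -/
def unitRep : KZ.IntegralRep 0 where
  domain := Set.univ
  integrand := fun _ => 1
  isSemialgebraic_domain := Literature.ModelTheory.ExponentialFields.isSemialgebraic_univ
  isSemialgebraicFunOn_integrand := by
    simpa using Literature.NumberTheory.Transcendental.isSemialgebraicFunOn_aeval
      (Literature.ModelTheory.ExponentialFields.isSemialgebraic_univ (k := ℚ) (ι := Fin 0) (R := ℝ))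
      (1 : MvPolynomial (Fin 0) ℚ)
  integrableOn := by
    have hvol : volume (Set.univ : Set (Fin 0 → ℝ)) = 1 := by
      rw [volume_pi, Measure.pi_univ]; simp
    exact integrableOn_const (hs := by simp [hvol])

/-- Every cube-Nash family HAS representations `sᵢ = [[0,1]^{nᵢ}, gᵢ]`, `u = [pt, 1]`.
[cite: KontsevichZagier2001, §1.1] -/
theorem exists_areRepsOf {S : ℕ} {n : Fin S → ℕ} {g : (i : Fin S) → (Fin (n i) → ℝ) → ℝ}
    {U : (i : Fin S) → Set (Fin (n i) → ℝ)} (hg : IsCubeNashFamily S n g U) :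
    ∃ (s : (i : Fin S) → KZ.IntegralRep (n i)) (u : KZ.IntegralRep 0), AreRepsOf S n g s u := by
  have hcube : ∀ i, Literature.ModelTheory.ExponentialFields.IsSemialgebraic ℚ
      (Set.pi Set.univ (fun _ : Fin (n i) => Set.Icc (0:ℝ) 1)) := fun i => by
    rw [← KZ.cube_eq_pi]; exact KZ.isSemialgebraic_cube
  refine ⟨fun i => cubeRep (n i) (g i) ((hg i).2.2.2.mono (hg i).2.1)
    ((hg i).2.2.1.mono (hg i).2.1 (hcube i)), unitRep, fun i => ⟨rfl, fun z _ => rfl⟩, rfl, fun _ => rfl⟩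

/-! ### The structure theorems -/

/-- **The bet implies `MovesLift`** (soundness of the KZ calculus: a relation has value `0`, so the
bet applies). [cite: KontsevichZagier2001, §1.2] -/
theorem movesLift_of_dilationLiftAtOne (hL : DilationLiftAtOne) : MovesLift := by
  intro S n g U hg m m₀ s u hsu hrel
  have hker := KZ.relations_le_ker_eval_holds hrel
  rw [AddMonoidHom.mem_ker, eval_combination m m₀ hsu] at hker
  exact hL S n g U hg m m₀ hker

/-- **`KZCube ∧ MovesLift` implies the bet**: the vanishing combination is a KZ relation by `KZCube`,
and relations lift by `MovesLift`. [cite: KontsevichZagier2001, §1.2 Conjecture 1] -/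
theorem dilationLiftAtOne_of_kzCube_of_movesLift (hK : KZCube) (hM : MovesLift) : DilationLiftAtOne := by
  intro S n g U hg m m₀ hsum
  obtain ⟨s, u, hsu⟩ := exists_areRepsOf hg
  exact hM S n g U hg m m₀ s u hsu (hK S n g U hg m m₀ s u hsu hsum)

/-- **The bet and `DilationTransfer` imply `KZCube`** (lift at `1`, then transfer at `ϖ₀ = 1`; this is
steps (3)–(4) of the route's assembly). [cite: AyoubRelKZRevisited, Théorème 1.7] -/
theorem kzCube_of_dilationTransfer_of_dilationLiftAtOne (hT : DilationTransfer) (hL : DilationLiftAtOne) :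
    KZCube := by
  intro S n g U hg m m₀ s u hsu hsum
  exact transfer_at_one hT hg m m₀ hsu (hL S n g U hg m m₀ hsum)

/-- **The exact strength of the bet.** Modulo the route's crux `DilationTransfer`,
`DilationLiftAtOne ↔ KZCube ∧ MovesLift`: the summit for cube-Nash combinations, plus the functional
lemma "KZ moves lift to the dilation pencil". [cite: KontsevichZagier2001, §1.2 Conjecture 1] -/
theorem dilationLiftAtOne_iff (hT : DilationTransfer) : DilationLiftAtOne ↔ KZCube ∧ MovesLift :=
  ⟨fun hL => ⟨kzCube_of_dilationTransfer_of_dilationLiftAtOne hT hL, movesLift_of_dilationLiftAtOne hL⟩,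
    fun h => dilationLiftAtOne_of_kzCube_of_movesLift h.1 h.2⟩

/-- The kernel form of the Kontsevich–Zagier conjecture implies `KZCube` (it IS `KZCube` for arbitrary
formal combinations). [cite: KontsevichZagier2001, §1.2 Conjecture 1] -/
theorem kzCube_of_kzKernelConjecture (h : KZKernelConjecture) : KZCube := by
  intro S n g U _ m m₀ s u hsu hsum
  apply h
  rw [eval_combination m m₀ hsu, hsum]

/-- **The summit implies `KZCube`** (summit = KZ-literal two-representation form ⇔ kernel form,
`kzKernelConjecture_iff_isRational`, proved in the tree). [cite: KontsevichZagier2001, §1.2 Conjecture 1] -/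
theorem kzCube_of_kontsevichZagierPeriods (h : KontsevichZagierPeriods) : KZCube :=
  kzCube_of_kzKernelConjecture (kzKernelConjecture_iff_isRational.mpr h)

/-- **The summit plus `MovesLift` implies the bet** — so every refutation of `DilationLiftAtOne` either
refutes the Kontsevich–Zagier conjecture or refutes `MovesLift`. [cite: KontsevichZagier2001, §1.2 Conjecture 1] -/
theorem dilationLiftAtOne_of_summit_of_movesLift (h : KontsevichZagierPeriods) (hM : MovesLift) :
    DilationLiftAtOne :=
  dilationLiftAtOne_of_kzCube_of_movesLift (kzCube_of_kontsevichZagierPeriods h) hM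

/-- Contrapositive bookkeeping for refuters: `¬ DilationLiftAtOne ∧ KontsevichZagierPeriods → ¬ MovesLift`.
[cite: KontsevichZagier2001, §1.2 Conjecture 1] -/
theorem not_movesLift_of_not_dilationLiftAtOne (h : KontsevichZagierPeriods) (hL : ¬ DilationLiftAtOne) :
    ¬ MovesLift :=
  fun hM => hL (dilationLiftAtOne_of_summit_of_movesLift h hM)

end Summit.KontsevichZagierPeriods.KontsevichZagierPeriods.Cruxes.DilationLiftAtOne.Structure
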